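import Summits.BirchSwinnertonDyer.BirchSwinnertonDyer.Theorems.ByReductionTypeAtTwoAdditivePotGoodKatoHalf
import HarnessLib

/-!
# Crux `AdditiveRankZeroAtTwo` (K4 item 19098): glue v4 is EXACT in its three non-conjectural children — the crux IMPLIES
# C2″ (reducible rest, upper half), C3″ (Eisenstein half) and, granted sibling 19096, C4″ (over-`K` on pot-mult) — seat
# `bsd-2adic-addL2x` GEN 11

Cell `bsd-2adic`, rung K4, crux stmt-BirchSwinnertonDyer-19098. `--supports 19098 --as helper`. HONEST FRAMING (D-0036/D-0054):
conditional theorems; closes nothing; nothing booked; BSD is not proved by any of this.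

WHAT THIS FILE RECORDS (witness-of-weakness bookkeeping for the planner's v2.2 split = the `_v4` binders verbatim). Of the four
research-grade children of `additiveRankZeroAtTwo_of_residual_v4`, three are CONSEQUENCES of the crux (so the split loses nothing
there), and one — C1″, statement (A) of Coates–Sujatha at `2` — is NOT implied by BSD₂ (the only lossy input, as (I1′) was in v3):
* `upperRest_of_additiveRankZeroAtTwo` — crux ⟹ C2″'s body (indeed the upper half on the whole additive class; GZK finiteness +
  `missingPPartAt_of_bsdp`).
* `lowerHalf_of_additiveRankZeroAtTwo` — crux ⟹ C3″'s body (the Eisenstein half on the whole additive class).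
* `potMultOverK_of_additiveRankZeroAtTwo` — crux + sibling `MultiplicativeRankZeroAtTwo` + PRINT {GZK, modularity, Milne any-model}
  ⟹ C4″'s body (the Hoffstein–Luo/any admissible twist of a pot-mult curve is multiplicative, `mult_of_semistableTwist_of_padicValRat_j_neg`;
  `AdditivePotMult.missingPPartOverCAt_baseChange_iff_bsdp`).
* `additiveRankZeroAtTwo_iff_residual_v4` — GRANTED PRINT + READINGS + `hMult` + C1″ (`hAna`): crux ⟺ C2″ ∧ C3″ ∧ C4″.

References: [Miller2011LMS] Def. 1.1; [Milne1972ArithmeticAV] §1 Thm. 1 (through [DokchitserDokchitserAnnals2010] §2.1);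
[Kato2004Asterisque] Thm. 12.5, Prop. 14.16 (2); [CoatesSujatha2005] statement (A).
-/

set_option autoImplicit false
set_option linter.dupNamespace false

noncomputable section

open scoped Classical

namespace Summit.BirchSwinnertonDyer.BirchSwinnertonDyer.Theorems.AddKatoTwo

open WeierstrassCurve Literature.NumberTheory.EllipticCurves
  Literature.NumberTheory.EllipticCurves.ModularForms
  Literature.NumberTheory.EllipticCurves.Kato2004
  Literature.NumberTheory.EllipticCurves.Rank1Residual
  Literature.NumberTheory.EllipticCurves.Rank1Residual.Typed
  Literature.NumberTheory.IwasawaTheory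
  Summit.BirchSwinnertonDyer.Rank1Residual Summit.BirchSwinnertonDyer.Rank1Residual.AdditivePotMult
  Summit.BirchSwinnertonDyer.Rank1Residual.X5.AddTwoL2
  Summit.BirchSwinnertonDyer.BirchSwinnertonDyer.Theses.ByReductionTypeAtTwo

/-- **Crux ⟹ the upper half on the whole additive class** (in particular C2″'s body): `BSDp ⟹ MissingUpperBoundAt`
(`missingPPartAt_of_bsdp`, `Ш` finite by GZK in analytic rank `0`). [cite: Miller2011LMS, §1 and Def. 1.1] -/
theorem upperRest_of_additiveRankZeroAtTwo (hGZK : rank_eq_analyticRank_of_analyticRank_le_one)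
    (h : Summit.BirchSwinnertonDyer.BirchSwinnertonDyer.Theses.ByReductionTypeAtTwo.AdditiveRankZeroAtTwo) :
    ∀ (W : WeierstrassCurve ℚ) [W.IsElliptic] [W.IsGloballyMinimal], ¬ W.HasCM → W.analyticRank = 0 →
      Addv W 2 → MissingUpperBoundAt W 2 := by
  intro W _ _ hcm hr hadd
  haveI : Fact (Nat.Prime 2) := ⟨Nat.prime_two⟩
  have hr1 : W.analyticRank ≤ 1 := by rw [hr]; exact zero_le_one
  haveI : Finite W.sha := (hGZK W hr1).2
  exact (lower_and_upper_of_missingPPartAt W 2 (missingPPartAt_of_bsdp W 2 (h W hcm hr hadd))).2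

/-- **Crux ⟹ the Eisenstein half on the whole additive class** (in particular C3″'s body). [cite: Miller2011LMS, §1 and Def. 1.1] -/
theorem lowerHalf_of_additiveRankZeroAtTwo (hGZK : rank_eq_analyticRank_of_analyticRank_le_one)
    (h : Summit.BirchSwinnertonDyer.BirchSwinnertonDyer.Theses.ByReductionTypeAtTwo.AdditiveRankZeroAtTwo) :
    ∀ (W : WeierstrassCurve ℚ) [W.IsElliptic] [W.IsGloballyMinimal], ¬ W.HasCM → W.analyticRank = 0 →
      Addv W 2 → MissingLowerBoundAt W 2 := by
  intro W _ _ hcm hr hadd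
  haveI : Fact (Nat.Prime 2) := ⟨Nat.prime_two⟩
  have hr1 : W.analyticRank ≤ 1 := by rw [hr]; exact zero_le_one
  haveI : Finite W.sha := (hGZK W hr1).2
  exact (lower_and_upper_of_missingPPartAt W 2 (missingPPartAt_of_bsdp W 2 (h W hcm hr hadd))).1

/-- **Crux + sibling 19096 ⟹ C4″'s body** (the `2`-part of BSD over every admissible twist-semistabilising quadratic field for a
potentially MULTIPLICATIVE curve): the semistable twist is multiplicative (`mult_of_semistableTwist_of_padicValRat_j_neg`), so `hMult`
gives `BSD₂(Wd)`, and `AdditivePotMult.missingPPartOverCAt_baseChange_iff_bsdp` (Milne any-model, GZK, modularity) converts `BSD₂(W)`.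
[cite: Milne1972ArithmeticAV, §1 Thm. 1 (through DokchitserDokchitserAnnals2010 §2.1)] -/
theorem potMultOverK_of_additiveRankZeroAtTwo (hGZK : rank_eq_analyticRank_of_analyticRank_le_one)
    (hmod : hasEntireLFunction_rat) (hMilneC : Milne1972.bsdQuotient_baseChange_quadratic_anyModel)
    (hMult : MultiplicativeRankZeroAtTwo)
    (h : Summit.BirchSwinnertonDyer.BirchSwinnertonDyer.Theses.ByReductionTypeAtTwo.AdditiveRankZeroAtTwo) :
    ∀ (W : WeierstrassCurve ℚ) [W.IsElliptic] [W.IsGloballyMinimal], ¬ W.HasCM → W.analyticRank = 0 →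
      Addv W 2 → padicValRat 2 W.j < 0 → ∀ (K : Type) [Field K] [NumberField K], Module.finrank ℚ K = 2 →
        SemistableTwistAtTwo W K → (W.quadraticTwist (NumberField.discr K : ℚ)).entireLFunction 1 ≠ 0 →
          MissingPPartOverCAt (W.baseChange K) 2 := by
  intro W _ _ hcm hr hadd hj K _ _ h2 hst hL
  haveI : Fact (Nat.Prime 2) := ⟨Nat.prime_two⟩
  obtain ⟨Wd, _, _, hWd, hcmd, hrd, hred⟩ := Theorems.exists_minimalTwist_semistable_rankZero W hcm K hst hL
  have hdK : (NumberField.discr K : ℚ) ≠ 0 := by exact_mod_cast NumberField.discr_ne_zero K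
  have hm : Mult Wd 2 := mult_of_semistableTwist_of_padicValRat_j_neg W hj hdK Wd hWd hred
  have hd : BSDp Wd 2 := hMult Wd hcmd hrd hm
  exact (missingPPartOverCAt_baseChange_iff_bsdp W 2 K Wd hGZK hmod hMilneC (by rw [hr]; exact zero_le_one) h2 hWd
    (by rw [hrd]; exact zero_le_one) hd).mpr (h W hcm hr hadd)

/-- **EXACTNESS of glue v4.** GRANTED PRINT {`hGZK`, `hmod`, `hmodN`, `hMilneC`, `hHL`, `hLim2`, `hFW`, `hCassels`, `hCT`} + READINGS
{`hSharp`, `hin`} + sibling `hMult` + C1″ (`hAna`): the crux `AdditiveRankZeroAtTwo` is EQUIVALENT to the conjunction of the bodies of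
C2″ (`hRest`), C3″ (`hLow`) and C4″ (`hQKm`). `←` is `additiveRankZeroAtTwo_of_residual_v4`; `→` the three theorems above (C1″ is the
only input of the split not implied by the crux). [cite: Miller2011LMS, §1 and Def. 1.1] [cite: Milne1972ArithmeticAV, §1 Thm. 1]
[cite: Kato2004Asterisque, Thm. 12.5 (1)(3), Prop. 14.16 (2)] [cite: CoatesSujatha2005, statement (A)] -/
theorem additiveRankZeroAtTwo_iff_residual_v4
    (hGZK : rank_eq_analyticRank_of_analyticRank_le_one) (hmod : hasEntireLFunction_rat) (hmodN : exists_isNewformOf)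
    (hMilneC : Milne1972.bsdQuotient_baseChange_quadratic_anyModel)
    (hHL : HoffsteinLuo1997_exists_twist_L_one_ne_zero)
    (hLim2 : Lim2017.thm35_at_two_fineSelmerDual_moduleFinite_of_classicalMuVanishes_of_le_divisionField_four)
    (hFW : ferreroWashington1979_classicalMuVanishes)
    (hCassels : bsdRHS_eq_of_isIsogenous) (hCT : exists_casselsTate_pairing (K := ℚ))
    (hSharp : Kato2004.rankZero_padicValNat_sha_add_padicValNat_tamagawa_le_at_two_of_irreducible_of_fineSelmerDual_fg)
    (hin : Kato2004.exists_memberHullInputs_two)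
    (hMult : MultiplicativeRankZeroAtTwo)
    (hAna : ∀ (W : WeierstrassCurve ℚ) [W.IsElliptic] [W.IsGloballyMinimal], ¬ W.HasCM → W.analyticRank = 0 →
      Addv W 2 → 0 ≤ padicValRat 2 W.j → ¬ IsAbelianGalois ℚ (W.divisionField 2) →
      ∀ (κ : ZpExtension ℚ 2), κ.IsCyclotomic →
        ∃ (γ : Field.absoluteGaloisGroup ℚ) (D : W.FineSelmerDualData κ γ),
          Module.Finite ℤ_[2] (RestrictScalars ℤ_[2] (IwasawaAlgebra 2) D.X)) :
    Summit.BirchSwinnertonDyer.BirchSwinnertonDyer.Theses.ByReductionTypeAtTwo.AdditiveRankZeroAtTwo ↔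
    ((∀ (W : WeierstrassCurve ℚ) [W.IsElliptic] [W.IsGloballyMinimal], ¬ W.HasCM → W.analyticRank = 0 →
        Addv W 2 → 0 ≤ padicValRat 2 W.j → ¬ W.HasIrreducibleModPGaloisRep 2 →
        ¬ ((∀ (W' : WeierstrassCurve ℚ) [W'.IsElliptic], IsIsogenous W W' → ¬ 2 ^ 2 ∣ W'.torsionOrder) ∧
            (∀ q : ℚ, shaAn W = (q : ℂ) → Even (padicValRat 2 q))) →
        MissingUpperBoundAt W 2) ∧
      (∀ (W : WeierstrassCurve ℚ) [W.IsElliptic] [W.IsGloballyMinimal], ¬ W.HasCM → W.analyticRank = 0 →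
        Addv W 2 → 0 ≤ padicValRat 2 W.j → MissingLowerBoundAt W 2) ∧
      (∀ (W : WeierstrassCurve ℚ) [W.IsElliptic] [W.IsGloballyMinimal], ¬ W.HasCM → W.analyticRank = 0 →
        Addv W 2 → padicValRat 2 W.j < 0 → ∀ (K : Type) [Field K] [NumberField K], Module.finrank ℚ K = 2 →
          SemistableTwistAtTwo W K → (W.quadraticTwist (NumberField.discr K : ℚ)).entireLFunction 1 ≠ 0 →
            MissingPPartOverCAt (W.baseChange K) 2)) := by
  constructor
  · intro h
    exact ⟨fun W _ _ hcm hr hadd _ _ _ => upperRest_of_additiveRankZeroAtTwo hGZK h W hcm hr hadd,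
      fun W _ _ hcm hr hadd _ => lowerHalf_of_additiveRankZeroAtTwo hGZK h W hcm hr hadd,
      potMultOverK_of_additiveRankZeroAtTwo hGZK hmod hMilneC hMult h⟩
  · rintro ⟨hRest, hLow, hQKm⟩
    exact additiveRankZeroAtTwo_of_residual_v4 hGZK hmod hmodN hMilneC hHL hLim2 hFW hCassels hCT hSharp hin hMult hAna
      hRest hLow hQKm

end Summit.BirchSwinnertonDyer.BirchSwinnertonDyer.Theorems.AddKatoTwo

end
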